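import Mathlib
import Summits.Ventures.PercRepro2.LocRows
import Summits.Ventures.PercRepro2.SwRow
import Summits.Ventures.PercRepro2.SwAllRow
import Summits.Ventures.PercRepro2.SwPair
import Summits.Ventures.PercRepro2.JointDom

/-!
# The rigid pairing form of row (SW): a rigid involution of `Q`
(blind cell PercRepro2, night-4 g7, 2026-08-25; proofs/NIGHT4-G6.md §10 addendum, §15)

The top of the ladder of census-true forms on `Q = {h ∉ H_l, o ∈ R_side(l)}`: an INVOLUTION `τ` of `Q`
under which every red edge inside the red cluster of `h` of either partner is blue in the other
(a configuration whose red cluster of `h` carries no red edge may be its own partner).  Census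
(night-4 g6, Edmonds blossom on the augmented graph): 0 failures in 42 / 460 / 5,633 cases at
`n = 4 / 5 / 6` (all connected graphs, all markings with `Q ≠ ∅`) and at `n = 7` for `m ≤ 10`.

`SwPairR ⟹ JointDomR ⟹ JointDom ⟹ Sw` and `SwPairR ⟹ SwPair` are kernel-checked here; with
`JointDom.lean`, `SwAllRow.lean` and `SwRow.lean` every rung of the ladder is a Prop in the tree and
every downward implication a theorem.
-/

namespace Summit.Ventures.PercRepro2

namespace LocRows

open Hull

variable {V : Type*} {E : Type*} [Fintype E] [DecidableEq E]

open scoped Classical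

variable (ends : E → Sym2 V)

/-- **The rigid pairing form**: an involution of `Q` under which every red edge inside the red
cluster of `h` of the source is blue in the partner (both ways, by the involution). -/
def SwPairR (l h o : V) : Prop :=
  ∃ τ : Config E → Config E,
    (∀ ζ ∈ tgtU ends l h {S : Set V | o ∈ S}, τ ζ ∈ tgtU ends l h {S : Set V | o ∈ S}) ∧
    (∀ ζ ∈ tgtU ends l h {S : Set V | o ∈ S}, τ (τ ζ) = ζ) ∧
    ∀ ζ ∈ tgtU ends l h {S : Set V | o ∈ S},
      ∀ e, e ∈ within ends (cluster ends ζ h) → ζ e = true → τ ζ e = false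

/-- **The rigid pairing form gives the rigid joint domination** (the partner's condition is the
same condition applied to the partner). -/
theorem jointDomR_of_swPairR {l h o : V} (hp : SwPairR ends l h o) : JointDomR ends l h o := by
  obtain ⟨τ, hmem, hinv, hrig⟩ := hp
  refine ⟨fun x => τ x.1, ?_, fun x => ⟨hmem x.1 x.2, hrig x.1 x.2, ?_⟩⟩
  · intro x y hxy
    have h1 : τ (τ x.1) = τ (τ y.1) := congrArg τ hxy
    rw [hinv x.1 x.2, hinv y.1 y.2] at h1
    exact Subtype.ext h1
  · intro e he hτ
    have := hrig (τ x.1) (hmem x.1 x.2) e he hτ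
    rwa [hinv x.1 x.2] at this

/-- **The rigid pairing form gives the pairing form** (`cluster_subset_of_red_flipped` both ways). -/
theorem swPair_of_swPairR {l h o : V} (hp : SwPairR ends l h o) : SwPair ends l h o := by
  obtain ⟨τ, hmem, hinv, hrig⟩ := hp
  refine ⟨τ, hmem, hinv, fun ζ hζ => ⟨?_, ?_⟩⟩
  · exact cluster_subset_of_red_flipped ends (hrig ζ hζ)
  · have := cluster_subset_of_red_flipped ends (hrig (τ ζ) (hmem ζ hζ))
    rwa [hinv ζ hζ] at this

/-- The rigid pairing form gives row 2′SW-ALL. -/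
theorem swAll_of_swPairR {l h o : V} (hp : SwPairR ends l h o) : SwAll ends l h o :=
  swAll_of_jointDomR ends (jointDomR_of_swPairR ends hp)

/-- The rigid pairing form gives row (SW). -/
theorem sw_of_swPairR {l h o : V} (hp : SwPairR ends l h o) : Sw ends l h o :=
  sw_of_jointDom ends (jointDom_of_jointDomR ends (jointDomR_of_swPairR ends hp))

/-- The rigid pairing form over all finite graphs and markings. -/
def SwPairR_all : Prop :=
  ∀ (V E : Type) [Fintype V] [DecidableEq V] [Fintype E] [DecidableEq E] (ends : E → Sym2 V)
    (l h o : V), l ≠ h → o ≠ l → o ≠ h → SwPairR ends l h o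

/-- `SwPairR_all` gives `JointDomR_all`. -/
theorem jointDomR_all_of_swPairR_all (hp : SwPairR_all) : JointDomR_all := by
  intro V E _ _ _ _ ends l h o hlh hol hoh
  exact jointDomR_of_swPairR ends (hp V E ends l h o hlh hol hoh)

/-- `SwPairR_all` gives `SwAll_all`, hence `Sw_all`. -/
theorem swAll_all_of_swPairR_all (hp : SwPairR_all) : SwAll_all :=
  swAll_all_of_jointDomR_all (jointDomR_all_of_swPairR_all hp)

/-- `SwPairR_all` gives `Sw_all`. -/
theorem sw_all_of_swPairR_all (hp : SwPairR_all) : Sw_all :=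
  sw_all_of_swAll_all (swAll_all_of_swPairR_all hp)

end LocRows

end Summit.Ventures.PercRepro2
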